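import Mathlib
import Summits.Ventures.PercRepro.TriangleCapRowA2

/-!
# PercRepro — THE `(j + 1)`-BROOM: the witness of every row `r = a + j` (p3, gen 48; part 202h)

`multiBroom k a j` on `Fin k` is `K_{a+1,k−a−1}` (small side `{0, …, a}`) minus the `(k − a − 2)`-star at `0` (`0` keeps
only `k − 1`) minus the `j` pairs `{1, a + 1}, …, {1, a + j}` — defined by deleting the pairs one at a time from
`bipMinusStar k (a + 1) (k − a − 2)` (`j = 1`: the broom of part 200p, `j = 2`: the double broom, `j = 3`: the triple
broom). With `j + 1` pairs it lies on the cell `(k, a, a + j)`: `a (k − a) − (a + j)` edges, `K₄⁻`-free (bipartite),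
`a`-bipartite for no `A` (the vertices `1, …, a` have degree `≥ a + 1`, so they are `A`, and `0 ∼ k − 1` outside), and
`Σ_v d(v)² + (a + j)(k − 1 − (a + j)) + (2 (k − a − 3) + 2j (a − 2)) = m k`: every row `r = a + j` of part 202g is
attained (`rowJ_nonbip_second_best`). Axioms: standard.
-/

namespace PercRepro

namespace TriangleCap

namespace C047

open Finset

/-- `K_{a+1,k−a−1}` minus the `(k − a − 2)`-star at `0` minus the pairs `{1, a + 1}, …, {1, a + i}` (`i` pairs). -/
def multiBroom (k a : ℕ) (h1 : 1 < k) : ℕ → SimpleGraph (Fin k)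
  | 0 => bipMinusStar k (a + 1) (k - a - 2)
  | i + 1 => if h : a + 1 + i < k then delEdge (multiBroom k a h1 i) ⟨1, h1⟩ ⟨a + 1 + i, h⟩
      else multiBroom k a h1 i

/-- Adjacency in `multiBroom` is decidable. -/
instance decidableRelMultiBroom (k a : ℕ) (h1 : 1 < k) : ∀ i, DecidableRel (multiBroom k a h1 i).Adj
  | 0 => inferInstanceAs (DecidableRel (bipMinusStar k (a + 1) (k - a - 2)).Adj)
  | i + 1 => by
    haveI := decidableRelMultiBroom k a h1 i
    unfold multiBroom
    split_ifs with h
    · exact inferInstanceAs (DecidableRel (delEdge (multiBroom k a h1 i) ⟨1, h1⟩ ⟨a + 1 + i, h⟩).Adj)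
    · exact inferInstance

/-- The recursion step. -/
theorem multiBroom_succ (k a : ℕ) (h1 : 1 < k) (i : ℕ) (h : a + 1 + i < k) :
    multiBroom k a h1 (i + 1) = delEdge (multiBroom k a h1 i) ⟨1, h1⟩ ⟨a + 1 + i, h⟩ := by
  show (if h : a + 1 + i < k then delEdge (multiBroom k a h1 i) ⟨1, h1⟩ ⟨a + 1 + i, h⟩
    else multiBroom k a h1 i) = _
  rw [dif_pos h]

/-- The degrees after the recursion step (instance-free form). -/
theorem deg_multiBroom_succ (k a : ℕ) (h1 : 1 < k) (i : ℕ) (h : a + 1 + i < k) (v : Fin k) :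
    deg (multiBroom k a h1 (i + 1)) v = deg (delEdge (multiBroom k a h1 i) ⟨1, h1⟩ ⟨a + 1 + i, h⟩) v := by
  unfold deg
  congr 1
  ext w
  simp only [mem_filter, mem_univ, true_and]
  rw [multiBroom_succ k a h1 i h]

/-- The edge count after the recursion step (instance-free form). -/
theorem card_edges_multiBroom_succ (k a : ℕ) (h1 : 1 < k) (i : ℕ) (h : a + 1 + i < k) :
    (multiBroom k a h1 (i + 1)).edgeFinset.card =
      (delEdge (multiBroom k a h1 i) ⟨1, h1⟩ ⟨a + 1 + i, h⟩).edgeFinset.card := by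
  have hs1 := sum_deg_eq (multiBroom k a h1 (i + 1))
  have hs2 := sum_deg_eq (delEdge (multiBroom k a h1 i) ⟨1, h1⟩ ⟨a + 1 + i, h⟩)
  rw [sum_congr rfl (fun v _ => deg_multiBroom_succ k a h1 i h v)] at hs1
  have h2 := hs1.symm.trans hs2
  omega

/-- The degree squares after the recursion step (instance-free form). -/
theorem sum_deg_sq_multiBroom_succ (k a : ℕ) (h1 : 1 < k) (i : ℕ) (h : a + 1 + i < k) :
    ∑ v, deg (multiBroom k a h1 (i + 1)) v * deg (multiBroom k a h1 (i + 1)) v =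
      ∑ v, deg (delEdge (multiBroom k a h1 i) ⟨1, h1⟩ ⟨a + 1 + i, h⟩) v *
        deg (delEdge (multiBroom k a h1 i) ⟨1, h1⟩ ⟨a + 1 + i, h⟩) v :=
  sum_congr rfl (fun v _ => by rw [deg_multiBroom_succ k a h1 i h v])

/-- `multiBroom k a i ≤ bipMinusStar k (a + 1) (k − a − 2)`. -/
theorem multiBroom_le (k a : ℕ) (h1 : 1 < k) (i : ℕ) : multiBroom k a h1 i ≤ bipMinusStar k (a + 1) (k - a - 2) := by
  induction i with
  | zero => exact le_refl _
  | succ i ih =>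
    unfold multiBroom
    split_ifs with h
    · exact le_trans (delEdge_le _ _ _) ih
    · exact ih

/-- The edge `{1, y}` for `a + 1 + i ≤ y < k` is present in `multiBroom k a i` (`2 ≤ a`). -/
theorem multiBroom_adj_one_aux (k a : ℕ) (h1 : 1 < k) (ha2 : 2 ≤ a) (i : ℕ) :
    ∀ (y : ℕ) (hy : y < k), a + 1 + i ≤ y → (multiBroom k a h1 i).Adj ⟨1, h1⟩ ⟨y, hy⟩ := by
  induction i with
  | zero =>
    intro y hy hya
    unfold multiBroom
    rw [bipMinusStar_adj]
    simp only
    refine ⟨?_, ?_⟩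
    · rw [Xor]; omega
    · omega
  | succ i ih =>
    intro y hy hya
    have hi' : a + 1 + i < k := by omega
    rw [multiBroom_succ k a h1 i hi', delEdge_adj]
    refine ⟨ih y hy (by omega), ?_⟩
    simp only [Fin.ext_iff]
    omega

/-- The edge `{1, a + 1 + i}` is present in `multiBroom k a i` (`2 ≤ a`, `a + 1 + i < k`). -/
theorem multiBroom_adj_one (k a : ℕ) (h1 : 1 < k) (ha2 : 2 ≤ a) (i : ℕ) (hi : a + 1 + i < k) :
    (multiBroom k a h1 i).Adj ⟨1, h1⟩ ⟨a + 1 + i, hi⟩ :=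
  multiBroom_adj_one_aux k a h1 ha2 i (a + 1 + i) hi (le_refl _)

/-- The degree of `1` in `multiBroom k a i`: `k − (a + 1) − i` (`2 ≤ a`, `a + 1 + i ≤ k`). -/
theorem deg_multiBroom_one (k a : ℕ) (h1 : 1 < k) (ha2 : 2 ≤ a) (i : ℕ) (hi : a + 1 + i ≤ k) :
    deg (multiBroom k a h1 i) ⟨1, h1⟩ + i = k - (a + 1) := by
  induction i with
  | zero =>
    unfold multiBroom
    rw [add_zero]
    have := deg_bipMinusStar_small k (a + 1) (k - a - 2) (by omega) (by omega) 1 (le_refl 1) (by omega)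
    exact this
  | succ i ih =>
    have hi' : a + 1 + i < k := by omega
    have hadj := multiBroom_adj_one k a h1 ha2 i hi'
    have h := deg_delEdge (multiBroom k a h1 i) hadj ⟨1, h1⟩
    rw [if_pos (Or.inl rfl)] at h
    rw [deg_multiBroom_succ k a h1 i hi']
    have := ih (by omega)
    omega

/-- The degree of a vertex `v ≠ 1` off the deleted leaves `a + 1, …, a + i` is that of `bipMinusStar`. -/
theorem deg_multiBroom_untouched (k a : ℕ) (h1 : 1 < k) (ha2 : 2 ≤ a) (i : ℕ) (hi : a + 1 + i ≤ k) (v : Fin k)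
    (hv1 : v.val ≠ 1) (hv : ¬ (a + 1 ≤ v.val ∧ v.val < a + 1 + i)) :
    deg (multiBroom k a h1 i) v = deg (bipMinusStar k (a + 1) (k - a - 2)) v := by
  induction i with
  | zero => rfl
  | succ i ih =>
    have hi' : a + 1 + i < k := by omega
    have hadj := multiBroom_adj_one k a h1 ha2 i hi'
    have h := deg_delEdge (multiBroom k a h1 i) hadj v
    have hne : ¬ (v = (⟨1, h1⟩ : Fin k) ∨ v = ⟨a + 1 + i, hi'⟩) := by
      simp only [Fin.ext_iff]
      omega
    rw [if_neg hne, add_zero] at h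
    rw [deg_multiBroom_succ k a h1 i hi', h]
    exact ih (by omega) (by omega)

/-- The degree of the leaf `a + 1 + i` in `multiBroom k a i` (before its deletion): `a` (`a + 3 + i ≤ k`: the leaf
is not `k − 1`). -/
theorem deg_multiBroom_leaf (k a : ℕ) (h1 : 1 < k) (ha2 : 2 ≤ a) (i : ℕ) (hi : a + 3 + i ≤ k) (v : Fin k)
    (hv : v.val = a + 1 + i) : deg (multiBroom k a h1 i) v = a := by
  rw [deg_multiBroom_untouched k a h1 ha2 i (by omega) v (by omega) (by omega)]
  rw [deg_bipMinusStar k (a + 1) (k - a - 2) (by omega) (by omega)]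
  have h0 : v.val ≠ 0 := by omega
  have hst : v ∈ rightStar k (a + 1) (k - a - 2) := by
    rw [rightStar, mem_filter]
    simp only [mem_univ, true_and]
    omega
  rw [if_neg h0, if_pos hst]
  omega

/-- The edge count of `multiBroom k a i`: `a (k − a) − (a − 1 + i)` (`2 ≤ a`, `a + 1 + i ≤ k`). -/
theorem card_edges_multiBroom (k a : ℕ) (h1 : 1 < k) (ha2 : 2 ≤ a) (i : ℕ) (hi : a + 2 + i ≤ k) :
    (multiBroom k a h1 i).edgeFinset.card + (a - 1 + i) = a * (k - a) := by
  induction i with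
  | zero =>
    show (bipMinusStar k (a + 1) (k - a - 2)).edgeFinset.card + (a - 1 + 0) = a * (k - a)
    have h := card_edges_bipMinusStar k (a + 1) (k - a - 2) (by omega) (by omega)
    obtain ⟨t, rfl⟩ : ∃ t, k = a + 2 + t := ⟨k - (a + 2), by omega⟩
    have e1 : a + 2 + t - a - 2 = t := by omega
    have e2 : a + 2 + t - (a + 1) = t + 1 := by omega
    have e3 : a + 2 + t - a = t + 2 := by omega
    rw [e1, e2] at h
    rw [e1, e3, add_zero]
    obtain ⟨a', rfl⟩ : ∃ a', a = a' + 2 := ⟨a - 2, by omega⟩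
    have e4 : a' + 2 - 1 = a' + 1 := by omega
    rw [e4]
    nlinarith [h]
  | succ i ih =>
    have hi' : a + 1 + i < k := by omega
    have hadj := multiBroom_adj_one k a h1 ha2 i hi'
    have h := card_edges_delEdge (multiBroom k a h1 i) hadj
    rw [card_edges_multiBroom_succ k a h1 i hi']
    have := ih (by omega)
    omega

/-- The degree squares of `multiBroom k a i`: `i (2k − 3 − i)` below those of `bipMinusStar` (`2 ≤ a`, `a + 2 + i ≤ k`). -/
theorem sum_deg_sq_multiBroom (k a : ℕ) (h1 : 1 < k) (ha2 : 2 ≤ a) (i : ℕ) (hi : a + 2 + i ≤ k) :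
    ∑ v, deg (multiBroom k a h1 i) v * deg (multiBroom k a h1 i) v + i * (2 * k - 3 - i) =
      ∑ v, deg (bipMinusStar k (a + 1) (k - a - 2)) v * deg (bipMinusStar k (a + 1) (k - a - 2)) v := by
  induction i with
  | zero =>
    show ∑ v, deg (bipMinusStar k (a + 1) (k - a - 2)) v * deg (bipMinusStar k (a + 1) (k - a - 2)) v +
      0 * (2 * k - 3 - 0) = _
    omega
  | succ i ih =>
    have hi' : a + 1 + i < k := by omega
    have hadj := multiBroom_adj_one k a h1 ha2 i hi'
    have h := sum_deg_sq_delEdge (multiBroom k a h1 i) hadj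
    rw [deg_multiBroom_leaf k a h1 ha2 i (by omega) ⟨a + 1 + i, hi'⟩ rfl] at h
    have h1' := deg_multiBroom_one k a h1 ha2 i (by omega)
    rw [sum_deg_sq_multiBroom_succ k a h1 i hi']
    have := ih (by omega)
    have e1 : (i + 1) * (2 * k - 3 - (i + 1)) + (2 * k - 2 * i - 4) + i * (2 * k - 3 - i) =
        (i + 1) * (2 * k - 3 - (i + 1)) + (i + 1) * (2 * k - 3 - (i + 1)) + 0 := by
      obtain ⟨t, rfl⟩ : ∃ t, k = a + 2 + i + t := ⟨k - (a + 2 + i), by omega⟩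
      have f1 : 2 * (a + 2 + i + t) - 3 - (i + 1) = 2 * a + i + 2 * t := by omega
      have f2 : 2 * (a + 2 + i + t) - 2 * i - 4 = 2 * a + 2 * t := by omega
      have f3 : 2 * (a + 2 + i + t) - 3 - i = 2 * a + i + 2 * t + 1 := by omega
      rw [f1, f2, f3]
      ring
    omega

/-- The edge `{0, k − 1}` survives every deletion (`a + 2 + i ≤ k`). -/
theorem multiBroom_adj_zero_last (k a : ℕ) (h1 : 1 < k) (i : ℕ) (hi : a + 2 + i ≤ k) :
    (multiBroom k a h1 i).Adj ⟨0, by omega⟩ ⟨k - 1, by omega⟩ := by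
  induction i with
  | zero =>
    unfold multiBroom
    rw [bipMinusStar_adj]
    simp only
    refine ⟨?_, ?_⟩
    · rw [Xor]; omega
    · omega
  | succ i ih =>
    have hi' : a + 1 + i < k := by omega
    rw [multiBroom_succ k a h1 i hi', delEdge_adj]
    refine ⟨ih (by omega), ?_⟩
    simp only [Fin.ext_iff]
    omega

/-- `multiBroom k a i` is `K₄⁻`-free (a subgraph of the bipartite `bipMinusStar`). -/
theorem k4mFree_multiBroom (k a : ℕ) (h1 : 1 < k) (i : ℕ) : K4mFree (multiBroom k a h1 i) :=
  k4mFree_of_le _ _ (multiBroom_le k a h1 i) (k4mFree_bipMinusStar k (a + 1) (k - a - 2))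

/-- `multiBroom k a i` is `a`-bipartite for no `A` (`2 ≤ a`, `2a + 2 + i ≤ k`): the vertices `1, …, a` have degree
`≥ a + 1`, so they are `A`, and `0 ∼ k − 1` outside. -/
theorem not_bipSub_multiBroom (k a : ℕ) (h1 : 1 < k) (ha2 : 2 ≤ a) (i : ℕ) (hk : 2 * a + 2 + i ≤ k) :
    ¬ ∃ A : Finset (Fin k), A.card = a ∧ BipSub (multiBroom k a h1 i) A := by
  rintro ⟨A, hA, hB⟩
  have hk0 : 0 < k := by omega
  have hin : ∀ v : Fin k, 1 ≤ v.val → v.val ≤ a → v ∈ A := by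
    intro v hv1 hva
    by_contra hvA
    have hle := deg_le_card_of_bipSub _ A hB v hvA
    rw [hA] at hle
    by_cases hv : v.val = 1
    · have hv' : v = ⟨1, h1⟩ := Fin.ext hv
      subst hv'
      have := deg_multiBroom_one k a h1 ha2 i (by omega)
      omega
    · have hu := deg_multiBroom_untouched k a h1 ha2 i (by omega) v hv (by omega)
      have hdeg : deg (bipMinusStar k (a + 1) (k - a - 2)) v = k - (a + 1) := by
        have := deg_bipMinusStar_small k (a + 1) (k - a - 2) (by omega) (by omega) v.val hv1 (by omega)
        convert this
      omega
  obtain ⟨S, hSdef⟩ : ∃ S : Finset (Fin k), S = Icc ⟨1, by omega⟩ ⟨a, by omega⟩ := ⟨_, rfl⟩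
  have hmemS : ∀ v : Fin k, v ∈ S ↔ 1 ≤ v.val ∧ v.val ≤ a := by
    intro v
    rw [hSdef, mem_Icc, Fin.le_def, Fin.le_def]
  have hScard : S.card = a := by
    rw [hSdef, Fin.card_Icc]
    simp only
    omega
  have hsub : S ⊆ A := fun v hv => hin v ((hmemS v).mp hv).1 ((hmemS v).mp hv).2
  have hSA : S = A := eq_of_subset_of_card_le hsub (by rw [hA, hScard])
  have h0 : (⟨0, hk0⟩ : Fin k) ∉ A := by
    rw [← hSA, hmemS]
    simp only
    omega
  have hlast : (⟨k - 1, by omega⟩ : Fin k) ∉ A := by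
    rw [← hSA, hmemS]
    simp only
    omega
  have := hB _ _ (multiBroom_adj_zero_last k a h1 i (by omega))
  tauto

/-- **THE `(j + 1)`-BROOM ATTAINS THE ROW `r = a + j`:** `multiBroom k a (j + 1)` is `K₄⁻`-free, has
`a (k − a) − (a + j)` edges, is `a`-bipartite for no `A`, and
`Σ_v d(v)² + (a + j)(k − 1 − (a + j)) + (2 (k − a − 3) + 2j (a − 2)) = m k` (`2 ≤ a`, `2a + 3 + j ≤ k`). -/
theorem multiBroom_value (k a j : ℕ) (h1 : 1 < k) (ha2 : 2 ≤ a) (hk : 2 * a + 3 + j ≤ k) :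
    K4mFree (multiBroom k a h1 (j + 1)) ∧
      (multiBroom k a h1 (j + 1)).edgeFinset.card + (a + j) = a * (k - a) ∧
      (¬ ∃ A : Finset (Fin k), A.card = a ∧ BipSub (multiBroom k a h1 (j + 1)) A) ∧
      ∑ v, deg (multiBroom k a h1 (j + 1)) v * deg (multiBroom k a h1 (j + 1)) v +
          (a + j) * (k - 1 - (a + j)) + (2 * (k - a - 3) + 2 * j * (a - 2)) =
        (multiBroom k a h1 (j + 1)).edgeFinset.card * k := by
  refine ⟨k4mFree_multiBroom k a h1 (j + 1), ?_, not_bipSub_multiBroom k a h1 ha2 (j + 1) (by omega), ?_⟩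
  · have h := card_edges_multiBroom k a h1 ha2 (j + 1) (by omega)
    have e : a - 1 + (j + 1) = a + j := by omega
    rw [e] at h
    exact h
  · have hE := card_edges_multiBroom k a h1 ha2 (j + 1) (by omega)
    have hS := sum_deg_sq_multiBroom k a h1 ha2 (j + 1) (by omega)
    have hS0 := (sums_bipMinusStar k (a + 1) (k - a - 2) (by omega) (by omega)).2
    generalize hSg : ∑ v, deg (multiBroom k a h1 (j + 1)) v * deg (multiBroom k a h1 (j + 1)) v = S at hS ⊢
    generalize hEg : (multiBroom k a h1 (j + 1)).edgeFinset.card = E at hE ⊢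
    generalize hS0g : ∑ v, deg (bipMinusStar k (a + 1) (k - a - 2)) v * deg (bipMinusStar k (a + 1) (k - a - 2)) v
      = S0 at hS hS0
    obtain ⟨t, rfl⟩ : ∃ t, k = 2 * a + 3 + j + t := ⟨k - (2 * a + 3 + j), by omega⟩
    obtain ⟨a', rfl⟩ : ∃ a', a = a' + 2 := ⟨a - 2, by omega⟩
    have e1 : a' + 2 - 1 + (j + 1) = a' + j + 2 := by omega
    have e2 : 2 * (a' + 2) + 3 + j + t - (a' + 2) = a' + 5 + j + t := by omega
    have e3 : 2 * (2 * (a' + 2) + 3 + j + t) - 3 - (j + 1) = 4 * a' + 10 + j + 2 * t := by omega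
    have e4 : 2 * (a' + 2) + 3 + j + t - (a' + 2) - 2 = a' + 3 + j + t := by omega
    have e5 : 2 * (2 * (a' + 2) + 3 + j + t) - (a' + 3 + j + t) - 1 = 3 * a' + 10 + j + t := by omega
    have e6 : 2 * (a' + 2) + 3 + j + t - (a' + 2 + 1) = a' + 4 + j + t := by omega
    have e7 : 2 * (a' + 2) + 3 + j + t - 1 - (a' + 2 + j) = a' + 4 + t := by omega
    have e8 : 2 * (a' + 2) + 3 + j + t - (a' + 2) - 3 = a' + 2 + j + t := by omega
    have e9 : a' + 2 - 2 = a' := by omega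
    rw [e1, e2] at hE
    rw [e3] at hS
    rw [e4, e5, e6] at hS0
    rw [e7, e8, e9]
    have hEk : (E + (a' + j + 2)) * (2 * (a' + 2) + 3 + j + t) =
        (a' + 2) * (a' + 5 + j + t) * (2 * (a' + 2) + 3 + j + t) := by rw [hE]
    linarith [hE, hS, hS0, hEk]

end C047

end TriangleCap

end PercRepro
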